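import Mathlib
import Literature.Analysis.SpecialFunctions.GaussLegendreQuadrature
import HarnessLib

/-!
# Convergence of sequences of integration rules: Pólya's criterion (sufficiency) and Stieltjes' theorem for the
# Gauss–Legendre rules
(Davis–Rabinowitz, *Methods of Numerical Integration*, 2nd ed. 1984, Sect. 2.7.8 "Convergence of Gaussian Rules":
the Theorem (2.7.8.1) and Pólya's Theorem (2.7.8.10)–(2.7.8.12) with the remark on positive weights)

## Statements

A sequence of rules `L_n f = Σ_{x ∈ S n} W n x · f x` with abscissas `S n ⊆ [a, b]` (a finite set of reals per `n`,
weights `W n`):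

* `tendsto_sum_mul_eval_of_tendsto_pow` — if the moments converge, `L_n(x^j) → ∫_a^b x^j` for every `j`
  ((2.7.8.11)), then `L_n p → ∫_a^b p` for every polynomial `p` (linearity).
* `tendsto_sum_mul_of_continuousOn` — PÓLYA (sufficiency half of (2.7.8.10) ⟺ (2.7.8.11) ∧ (2.7.8.12)): moments
  converge and `Σ_x |W n x| ≤ M` for all `n` ⟹ `L_n f → ∫_a^b f` for every `f ∈ C[a, b]`.
* `tendsto_sum_mul_of_continuousOn_of_nonneg` — the remark after (2.7.8.12): for non-negative weights (2.7.8.11)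
  implies (2.7.8.12) (`Σ |W| = L_n(1) → b - a` is bounded), so moment convergence alone suffices.
* `tendsto_pow_of_eventually_eq_integral` — "if the formula is of interpolatory type … (2.7.8.11) will be
  fulfilled": rules eventually exact on each monomial have convergent moments.
* `tendsto_gaussLegendre_of_continuousOn`, `tendsto_integral_sub_gaussLegendre` — STIELTJES' THEOREM (2.7.8.1):
  for `f ∈ C[-1, 1]`, `G_n f → ∫_{-1}^{1} f`, i.e. `E_{G_n}(f) → 0`, for the Gauss–Legendre rules of
  `Literature.Analysis.SpecialFunctions.GaussLegendreQuadrature` (positive weights, exact in degree `< 2n`, nodes in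
  `(-1, 1)`).

## Hypotheses

`a ≤ b`; abscissas in `[a, b]`; `f` continuous on `[a, b]`. The necessity half of Pólya's theorem ((2.7.8.10) ⟹
(2.7.8.12), uniform boundedness) and the extension to Riemann-integrable `f` ((2.7.8.9)) are NOT treated here.

## Proof

As printed for (2.7.8.1): given `ε`, Weierstrass (`exists_polynomial_near_of_continuousOn`) gives a polynomial `p`
with `|f - p| < δ` on `[a, b]`; split `L_n f - ∫ f = L_n(f - p) + (L_n p - ∫ p) + ∫ (p - f)`, bounded by
`M δ + o(1) + (b - a) δ`.

## Prior art in the tree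

`GaussLegendreQuadrature` (exactness, positivity, `Σ λ = 2`), `GaussLegendreError`/`GaussLegendreAnalytic*` (error
representations and rates for smooth/analytic integrands); no convergence theorem for merely continuous integrands and
no Pólya-type criterion for general rule sequences was in the tree (census: no `exists_polynomial_near`/Weierstrass use
under `Literature/Analysis/Quadrature` or `…/SpecialFunctions/GaussLegendre*`).

## Engine use

Anchor M53 of the QUAD-3 lane (shared numerical engines serving client cells; rigour lives in the verifiers; every
published number belongs to a client cell's ledger, not to the engines group): the qualitative guarantee behind every
positive-weight rule family the engines tabulate (Gauss, Clenshaw–Curtis, composite Newton–Cotes of low order) —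
refinement converges for any continuous integrand, with the two checkable hypotheses (moments, `Σ|W|`) isolated.

## References

* [DavisRabinowitz1984] P. J. Davis, P. Rabinowitz, *Methods of Numerical Integration*, 2nd ed., Academic Press 1984,
  Sect. 2.7.8 "Convergence of Gaussian Rules": Theorem (2.7.8.1) (Stieltjes) with its proof; Pólya's Theorem
  (2.7.8.10)–(2.7.8.12) and the remarks following it (positive weights; interpolatory type).
-/

namespace Literature.Analysis.Quadrature

open Set MeasureTheory intervalIntegral Finset Polynomial Filter
open scoped Topology

section Polya

variable {S : ℕ → Finset ℝ} {W : ℕ → ℝ → ℝ} {a b : ℝ}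

/-- **Moment convergence extends to polynomials**: if `L_n(x^j) → ∫_a^b x^j dx` for every `j` ((2.7.8.11)), then
`L_n p → ∫_a^b p` for every polynomial `p`. [cite: DavisRabinowitz1984, Sect. 2.7.8 (2.7.8.11)] -/
theorem tendsto_sum_mul_eval_of_tendsto_pow
    (hmom : ∀ j : ℕ, Tendsto (fun n => ∑ x ∈ S n, W n x * x ^ j) atTop (𝓝 (∫ t in a..b, t ^ j)))
    (p : ℝ[X]) :
    Tendsto (fun n => ∑ x ∈ S n, W n x * p.eval x) atTop (𝓝 (∫ t in a..b, p.eval t)) := by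
  have hrule : ∀ n, ∑ x ∈ S n, W n x * p.eval x
      = ∑ i ∈ range (p.natDegree + 1), p.coeff i * ∑ x ∈ S n, W n x * x ^ i := by
    intro n
    have h1 : ∀ x ∈ S n, W n x * p.eval x = ∑ i ∈ range (p.natDegree + 1), p.coeff i * (W n x * x ^ i) := by
      intro x _
      rw [eval_eq_sum_range, mul_sum]
      exact sum_congr rfl fun i _ => by ring
    rw [sum_congr rfl h1, sum_comm]
    exact sum_congr rfl fun i _ => (mul_sum _ _ _).symm
  have hint : ∫ t in a..b, p.eval t
      = ∑ i ∈ range (p.natDegree + 1), p.coeff i * ∫ t in a..b, t ^ i := by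
    have h1 : (fun t => p.eval t) = fun t => ∑ i ∈ range (p.natDegree + 1), p.coeff i * t ^ i := by
      funext t
      exact eval_eq_sum_range t
    rw [h1, intervalIntegral.integral_finsetSum]
    · exact sum_congr rfl fun i _ => intervalIntegral.integral_const_mul _ _
    · intro i _
      exact (continuous_const.mul (continuous_pow i)).intervalIntegrable _ _
  simp_rw [hrule]
  rw [hint]
  exact tendsto_finsetSum _ fun i _ => (hmom i).const_mul _

/-- **Pólya's theorem, sufficiency** ((2.7.8.11) ∧ (2.7.8.12) ⟹ (2.7.8.10)): let `L_n f = Σ_{x ∈ S n} W n x f(x)` with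
abscissas in `[a, b]`. If `L_n(x^j) → ∫_a^b x^j dx` for `j = 0, 1, …` and `Σ_x |W n x| ≤ M` for all `n`, then
`L_n f → ∫_a^b f` for every `f ∈ C[a, b]`. (The converse, via uniform boundedness, is not formalised here.)
[cite: DavisRabinowitz1984, Sect. 2.7.8 (2.7.8.10)-(2.7.8.12)] -/
theorem tendsto_sum_mul_of_continuousOn {M : ℝ} (hab : a ≤ b) (hS : ∀ n, ∀ x ∈ S n, x ∈ Icc a b)
    (hM : ∀ n, ∑ x ∈ S n, |W n x| ≤ M)
    (hmom : ∀ j : ℕ, Tendsto (fun n => ∑ x ∈ S n, W n x * x ^ j) atTop (𝓝 (∫ t in a..b, t ^ j)))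
    {f : ℝ → ℝ} (hf : ContinuousOn f (Icc a b)) :
    Tendsto (fun n => ∑ x ∈ S n, W n x * f x) atTop (𝓝 (∫ t in a..b, f t)) := by
  have hM0 : 0 ≤ M := le_trans (sum_nonneg fun x _ => abs_nonneg (W 0 x)) (hM 0)
  have hba : 0 ≤ b - a := sub_nonneg.2 hab
  have hK : 0 < M + (b - a) + 1 := by linarith
  have hKne : M + (b - a) + 1 ≠ 0 := hK.ne'
  rw [Metric.tendsto_atTop]
  intro ε hε
  set δ := ε / (2 * (M + (b - a) + 1)) with hδ
  have hδpos : 0 < δ := by positivity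
  obtain ⟨p, hp⟩ := exists_polynomial_near_of_continuousOn a b f hf δ hδpos
  obtain ⟨N, hN⟩ :=
    Metric.tendsto_atTop.1 (tendsto_sum_mul_eval_of_tendsto_pow hmom p) (ε / 2) (half_pos hε)
  refine ⟨N, fun n hn => ?_⟩
  have h1 : |∑ x ∈ S n, W n x * f x - ∑ x ∈ S n, W n x * p.eval x| ≤ M * δ := by
    rw [← sum_sub_distrib]
    calc |∑ x ∈ S n, (W n x * f x - W n x * p.eval x)|
        ≤ ∑ x ∈ S n, |W n x * f x - W n x * p.eval x| := abs_sum_le_sum_abs _ _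
      _ = ∑ x ∈ S n, |W n x| * |p.eval x - f x| := by
          refine sum_congr rfl fun x _ => ?_
          rw [← mul_sub, abs_mul, abs_sub_comm]
      _ ≤ ∑ x ∈ S n, |W n x| * δ := by
          gcongr with x hx
          exact (hp x (hS n x hx)).le
      _ = (∑ x ∈ S n, |W n x|) * δ := (sum_mul _ _ _).symm
      _ ≤ M * δ := by gcongr; exact hM n
  have h2 : |∑ x ∈ S n, W n x * p.eval x - ∫ t in a..b, p.eval t| < ε / 2 := by
    have h := hN n hn
    rwa [Real.dist_eq] at h
  have h3 : |(∫ t in a..b, p.eval t) - ∫ t in a..b, f t| ≤ δ * (b - a) := by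
    rw [← intervalIntegral.integral_sub (p.continuous.intervalIntegrable a b) (hf.intervalIntegrable_of_Icc hab)]
    have key : ‖∫ t in a..b, (p.eval t - f t)‖ ≤ δ * |b - a| := by
      refine intervalIntegral.norm_integral_le_of_norm_le_const fun x hx => ?_
      rw [uIoc_of_le hab] at hx
      rw [Real.norm_eq_abs]
      exact (hp x (Ioc_subset_Icc_self hx)).le
    rwa [Real.norm_eq_abs, abs_of_nonneg hba] at key
  have hsplit : |∑ x ∈ S n, W n x * f x - ∫ t in a..b, f t|
      ≤ |∑ x ∈ S n, W n x * f x - ∑ x ∈ S n, W n x * p.eval x|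
        + |∑ x ∈ S n, W n x * p.eval x - ∫ t in a..b, p.eval t|
        + |(∫ t in a..b, p.eval t) - ∫ t in a..b, f t| := by
    have i1 := abs_sub_le (∑ x ∈ S n, W n x * f x) (∑ x ∈ S n, W n x * p.eval x) (∫ t in a..b, f t)
    have i2 := abs_sub_le (∑ x ∈ S n, W n x * p.eval x) (∫ t in a..b, p.eval t) (∫ t in a..b, f t)
    linarith
  have hδK : (M + (b - a) + 1) * δ = ε / 2 := by
    rw [hδ]
    field_simp
  have hmain : M * δ + δ * (b - a) < ε / 2 := by
    have h : M * δ + δ * (b - a) = ε / 2 - δ := by linear_combination hδK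
    rw [h]
    linarith
  rw [Real.dist_eq]
  linarith

/-- **Positive weights** (the remark after (2.7.8.12)): if the weights are non-negative then (2.7.8.11) implies
(2.7.8.12), since `Σ_x |W n x| = L_n(1) → b - a` is bounded; hence moment convergence alone gives `L_n f → ∫_a^b f`
for every `f ∈ C[a, b]`. [cite: DavisRabinowitz1984, Sect. 2.7.8 (2.7.8.12)] -/
theorem tendsto_sum_mul_of_continuousOn_of_nonneg (hab : a ≤ b) (hS : ∀ n, ∀ x ∈ S n, x ∈ Icc a b)
    (hW : ∀ n, ∀ x ∈ S n, 0 ≤ W n x)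
    (hmom : ∀ j : ℕ, Tendsto (fun n => ∑ x ∈ S n, W n x * x ^ j) atTop (𝓝 (∫ t in a..b, t ^ j)))
    {f : ℝ → ℝ} (hf : ContinuousOn f (Icc a b)) :
    Tendsto (fun n => ∑ x ∈ S n, W n x * f x) atTop (𝓝 (∫ t in a..b, f t)) := by
  have h0 : Tendsto (fun n => ∑ x ∈ S n, W n x) atTop (𝓝 (b - a)) := by
    have h := hmom 0
    simp only [pow_zero, mul_one, intervalIntegral.integral_const, smul_eq_mul] at h
    exact h
  obtain ⟨N, hN⟩ := Metric.tendsto_atTop.1 h0 1 one_pos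
  have hnn : ∀ m, 0 ≤ ∑ x ∈ S m, W m x := fun m => sum_nonneg (hW m)
  refine tendsto_sum_mul_of_continuousOn (M := b - a + 1 + ∑ m ∈ range N, ∑ x ∈ S m, W m x) hab hS
    (fun n => ?_) hmom hf
  rw [sum_congr rfl fun x hx => abs_of_nonneg (hW n x hx)]
  have hsumN : 0 ≤ ∑ m ∈ range N, ∑ x ∈ S m, W m x := sum_nonneg fun m _ => hnn m
  by_cases hn : N ≤ n
  · have h := hN n hn
    rw [Real.dist_eq, abs_lt] at h
    linarith
  · have hmem : n ∈ range N := mem_range.2 (not_le.1 hn)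
    have h := single_le_sum (f := fun m => ∑ x ∈ S m, W m x) (fun m _ => hnn m) hmem
    have hba : 0 ≤ b - a := sub_nonneg.2 hab
    linarith

/-- **Interpolatory type gives (2.7.8.11)**: if, for each `j`, the rules are eventually exact on `x^j` (as for any
sequence of rules of increasing polynomial degree), the moments converge trivially.
[cite: DavisRabinowitz1984, Sect. 2.7.8 (2.7.8.11)] -/
theorem tendsto_pow_of_eventually_eq_integral
    (hexact : ∀ j : ℕ, ∀ᶠ n in atTop, ∑ x ∈ S n, W n x * x ^ j = ∫ t in a..b, t ^ j) (j : ℕ) :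
    Tendsto (fun n => ∑ x ∈ S n, W n x * x ^ j) atTop (𝓝 (∫ t in a..b, t ^ j)) :=
  tendsto_const_nhds.congr' ((hexact j).mono fun _ hn => hn.symm)

end Polya

section Stieltjes

open Literature.Analysis.SpecialFunctions

/-- **Stieltjes' theorem** ((2.7.8.1)): for every `f ∈ C[-1, 1]` the Gauss–Legendre rules converge,
`G_n f = Σ_{x ∈ gaussLegendreNodes n} λ_{n,x} f(x) → ∫_{-1}^{1} f`. Proof as printed: positive weights, exactness in
degree `≤ 2n - 1`, Weierstrass. [cite: DavisRabinowitz1984, Sect. 2.7.8 Theorem (2.7.8.1)] -/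
theorem tendsto_gaussLegendre_of_continuousOn {f : ℝ → ℝ} (hf : ContinuousOn f (Icc (-1) 1)) :
    Tendsto (fun n => ∑ x ∈ gaussLegendreNodes n, gaussLegendreWeight n x * f x) atTop
      (𝓝 (∫ t in (-1 : ℝ)..1, f t)) := by
  refine tendsto_sum_mul_of_continuousOn_of_nonneg (S := gaussLegendreNodes) (W := gaussLegendreWeight)
    (by norm_num) (fun _ x hx => Ioo_subset_Icc_self (mem_Ioo_of_mem_gaussLegendreNodes hx))
    (fun _ x hx => (gaussLegendreWeight_pos hx).le) (tendsto_pow_of_eventually_eq_integral fun j => ?_) hf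
  filter_upwards [eventually_ge_atTop (j + 1)] with n hn
  have h := integral_eq_sum_gaussLegendreWeight_mul (n := n) (f := X ^ j) (by rw [natDegree_X_pow]; omega)
  simp only [eval_pow, eval_X] at h
  exact h.symm

/-- **Stieltjes' theorem, error form** ((2.7.8.1) as printed: `lim_{n→∞} E_{G_n}(f) = 0` with
`E_{G_n}(f) = ∫_{-1}^{1} f - G_n f`). [cite: DavisRabinowitz1984, Sect. 2.7.8 Theorem (2.7.8.1)] -/
theorem tendsto_integral_sub_gaussLegendre {f : ℝ → ℝ} (hf : ContinuousOn f (Icc (-1) 1)) :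
    Tendsto (fun n => (∫ t in (-1 : ℝ)..1, f t) - ∑ x ∈ gaussLegendreNodes n, gaussLegendreWeight n x * f x)
      atTop (𝓝 0) := by
  have h := (tendsto_gaussLegendre_of_continuousOn hf).const_sub (∫ t in (-1 : ℝ)..1, f t)
  rwa [sub_self] at h

end Stieltjes

end Literature.Analysis.Quadrature
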